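import Literature.Computability.MetaComplexity.LineDesigns
import Literature.Computability.Complexity.GoldwasserSipserRefereeBricks
import Literature.Computability.Complexity.FoldCatBricks
import HarnessLib

/-!
# The Nisan–Wigderson generator on the design of lines as an `FP` string function

Topic `Literature/Computability/MetaComplexity`, machine layer of `NWStrings.lean` / `LineDesigns.lean`
for Hirahara's reduction (FOCS 2018 / ECCC TR18-138, Def. 4.5, Lemma 4.10: "Compute … `f := Enc(x)` and
the design `S_{m,ℓ,d}`. Output `NW^f_{m,d}(z)`. It is easy to see that the running time of this
algorithm is at most `t + poly(n, 1/δ, m, d)`"). On the design of lines the blocks need not be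
materialised: the symbol of block `j` at abscissa `t` is the closed formula `lineVal q j t`, so the
generator is two nested counted folds (`Brick.runFold`, pieces clipped by `pclipF`) around unary
arithmetic (`divModFn`, `umulFn`) and positional bit access (`dropFn`, `headBitFn`):

* `NWLine.lineValF` — `⟨⟨1^q, 1ʲ⟩, 1ᵗ⟩ ↦ 1^{lineVal q j t}`;
* `NWLine.resBitF`, `NWLine.resF` — the restriction `z|_{S_j}` (`NWStr.resBits q (lineWord q ℓ j) z`)
  from the context `⟨⟨f, z⟩, ⟨1^q, ⟨1^ℓ, 1^m⟩⟩⟩` and `1ʲ`;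
* `NWLine.fAtF` — `⟨y, f⟩ ↦ [f(y)]` (`NWStr.fAt`); `NWLine.yBitF` — `[f(z|_{S_j})]`;
* **`NWLine.nwEvalF`** — `⟨⟨f, z⟩, ⟨1^q, ⟨1^ℓ, 1^m⟩⟩⟩ ↦ NW^f(z) = NWStr.nwOut q f (lineDesign q ℓ m) z`
  (`nwEvalF_apply`), in `FP` (`nwEvalF_mem_FP`).

## References

* S. Hirahara, ECCC TR18-138 (2018), Def. 4.5, Lemma 4.10 (proof).
* N. Nisan, A. Wigderson, JCSS 49 (1994), §2, Lemma 2.5.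
* S. Arora, B. Barak, *Computational Complexity: A Modern Approach*, CUP 2009, §1.3 (bounded loops).
-/

noncomputable section

namespace Literature.Computability.MetaComplexity

open _root_.Computability Polynomial Complexity Complexity.Brick Complexity.Plumb Complexity.OracleCompose Complexity.HashBricks

namespace NWLine

/-! ### The symbol of a block: `lineVal` in unary -/

/-- `⟨⟨1^q, 1ʲ⟩, 1ᵗ⟩ ↦ 1^{lineVal q j t}`: divide `j` by `q`, multiply the quotient by `t`, add the
remainder, reduce mod `q`. [cite: NisanWigderson1994, Lemma 2.5] -/
def lineValF : List Bool → List Bool :=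
  sndF ∘ divModFn ∘ fanoutFn (fstF ∘ fstF)
    (fun w => (umulFn ∘ fanoutFn (fstF ∘ divModFn ∘ fstF) sndF) w ++ (sndF ∘ divModFn ∘ fstF) w)

/-- Value of `lineValF`. [folklore] -/
theorem lineValF_apply (q j t : ℕ) : lineValF (boolPair (boolPair (ones q) (ones j)) (ones t)) = ones (LineDesign.lineVal q j t) := by
  simp only [lineValF, Function.comp_apply, fanoutFn_apply, fstF_boolPair, sndF_boolPair, divModFn_boolPair, umulFn_boolPair]
  rw [show ones (j / q * t) ++ ones (j % q) = ones (j / q * t + j % q) by simp [ones], divModFn_boolPair,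
    sndF_boolPair, LineDesign.lineVal]

/-- `lineValF ∈ FP`. [folklore] -/
theorem lineValF_mem_FP : lineValF ∈ FP :=
  comp_mem_FP sndF_mem_FP (comp_mem_FP divModFn_mem_FP (fanoutFn_mem_FP (comp_mem_FP fstF_mem_FP fstF_mem_FP)
    (append_mem_FP (comp_mem_FP umulFn_mem_FP (fanoutFn_mem_FP (comp_mem_FP fstF_mem_FP (comp_mem_FP divModFn_mem_FP fstF_mem_FP)) sndF_mem_FP))
      (comp_mem_FP sndF_mem_FP (comp_mem_FP divModFn_mem_FP fstF_mem_FP)))))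

/-! ### The evaluation context `⟨⟨f, z⟩, ⟨1^q, ⟨1^ℓ, 1^m⟩⟩⟩` -/

/-- The evaluation context. [folklore] -/
def ectx (f z : List Bool) (q ℓ m : ℕ) : List Bool := boolPair (boolPair f z) (boolPair (ones q) (boolPair (ones ℓ) (ones m)))

/-- `f`. [folklore] -/
def eF : List Bool → List Bool := fstF ∘ fstF
/-- `z`. [folklore] -/
def eZ : List Bool → List Bool := sndF ∘ fstF
/-- `1^q`. [folklore] -/
def eQ : List Bool → List Bool := nthF 0 ∘ sndF
/-- `1^ℓ`. [folklore] -/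
def eL : List Bool → List Bool := nthF 1 ∘ sndF
/-- `1^m`. [folklore] -/
def eM : List Bool → List Bool := sndPow 1 ∘ sndF

/-- The projection `eF` evaluated on the evaluation context. [folklore] -/
@[simp] theorem eF_ectx (f z : List Bool) (q ℓ m : ℕ) : eF (ectx f z q ℓ m) = f := by simp [eF, ectx]
/-- The projection `eZ` evaluated on the evaluation context. [folklore] -/
@[simp] theorem eZ_ectx (f z : List Bool) (q ℓ m : ℕ) : eZ (ectx f z q ℓ m) = z := by simp [eZ, ectx]
/-- The projection `eQ` evaluated on the evaluation context. [folklore] -/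
@[simp] theorem eQ_ectx (f z : List Bool) (q ℓ m : ℕ) : eQ (ectx f z q ℓ m) = ones q := by simp [eQ, ectx]
/-- The projection `eL` evaluated on the evaluation context. [folklore] -/
@[simp] theorem eL_ectx (f z : List Bool) (q ℓ m : ℕ) : eL (ectx f z q ℓ m) = ones ℓ := by simp [eL, ectx]
/-- The projection `eM` evaluated on the evaluation context. [folklore] -/
@[simp] theorem eM_ectx (f z : List Bool) (q ℓ m : ℕ) : eM (ectx f z q ℓ m) = ones m := by simp [eM, ectx, sndPow]

/-- `eF` is polynomial-time computable (`FP`). [folklore] -/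
theorem eF_mem_FP : eF ∈ FP := comp_mem_FP fstF_mem_FP fstF_mem_FP
/-- `eZ` is polynomial-time computable (`FP`). [folklore] -/
theorem eZ_mem_FP : eZ ∈ FP := comp_mem_FP sndF_mem_FP fstF_mem_FP
/-- `eQ` is polynomial-time computable (`FP`). [folklore] -/
theorem eQ_mem_FP : eQ ∈ FP := comp_mem_FP (nthF_mem_FP 0) sndF_mem_FP
/-- `eL` is polynomial-time computable (`FP`). [folklore] -/
theorem eL_mem_FP : eL ∈ FP := comp_mem_FP (nthF_mem_FP 1) sndF_mem_FP
/-- `eM` is polynomial-time computable (`FP`). [folklore] -/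
theorem eM_mem_FP : eM ∈ FP := comp_mem_FP (sndPow_mem_FP 1) sndF_mem_FP

/-- A concatenation of singletons is a `map` over `range`. [folklore] -/
theorem ccat_singleton (g : ℕ → Bool) : ∀ n : ℕ, ccat (fun t => [g t]) n = (List.range n).map g
  | 0 => rfl
  | n + 1 => by rw [ccat_succ, ccat_singleton g n, List.range_succ, List.map_append, List.map_singleton]

/-- Length of the evaluation context dominates its unary fields. [folklore] -/
theorem le_length_ectx (f z : List Bool) (q ℓ m : ℕ) : q + ℓ + m ≤ (ectx f z q ℓ m).length := by
  simp only [ectx, length_boolPair, ones, List.length_replicate]; omega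

/-! ### The restriction of the seed to a block -/

/-- **One bit of the restriction**: on `⟨⟨ctx, 1ʲ⟩, 1ᵗ⟩`, the seed bit at position `t·q + lineVal q j t`.
[cite: Hirahara2018, Def. 4.5 (`z_S`)] -/
def resBitF : List Bool → List Bool :=
  headBitFn ∘ dropFn ∘ fanoutFn
    (fun w => (umulFn ∘ fanoutFn sndF (eQ ∘ fstF ∘ fstF)) w ++ (lineValF ∘ fanoutFn (fanoutFn (eQ ∘ fstF ∘ fstF) (sndF ∘ fstF)) sndF) w)
    (eZ ∘ fstF ∘ fstF)

/-- Value of `resBitF`. [folklore] -/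
theorem resBitF_apply (f z : List Bool) (q ℓ m j t : ℕ) :
    resBitF (boolPair (boolPair (ectx f z q ℓ m) (ones j)) (ones t)) = [z.getD (t * q + LineDesign.lineVal q j t) false] := by
  simp only [resBitF, Function.comp_apply, fanoutFn_apply, fstF_boolPair, sndF_boolPair, eQ_ectx, eZ_ectx, umulFn_boolPair, lineValF_apply]
  rw [show ones (t * q) ++ ones (LineDesign.lineVal q j t) = ones (t * q + LineDesign.lineVal q j t) by simp [ones],
    dropFn_boolPair, headBitFn_apply]
  simp only [ones, List.length_replicate, List.getD_eq_getElem?_getD, List.head?_drop, List.headD_eq_head?_getD]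

/-- `resBitF ∈ FP`. [folklore] -/
theorem resBitF_mem_FP : resBitF ∈ FP :=
  comp_mem_FP headBitFn_mem_FP (comp_mem_FP dropFn_mem_FP (fanoutFn_mem_FP
    (append_mem_FP (comp_mem_FP umulFn_mem_FP (fanoutFn_mem_FP sndF_mem_FP (comp_mem_FP eQ_mem_FP (comp_mem_FP fstF_mem_FP fstF_mem_FP))))
      (comp_mem_FP lineValF_mem_FP (fanoutFn_mem_FP (fanoutFn_mem_FP (comp_mem_FP eQ_mem_FP (comp_mem_FP fstF_mem_FP fstF_mem_FP)) (comp_mem_FP sndF_mem_FP fstF_mem_FP)) sndF_mem_FP)))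
    (comp_mem_FP eZ_mem_FP (comp_mem_FP fstF_mem_FP fstF_mem_FP))))

/-- **The restriction `z|_{S_j}`**: on `C = ⟨ctx, 1ʲ⟩`, the concatenation fold of the `ℓ` bits.
[cite: Hirahara2018, Def. 4.5] -/
def resF : List Bool → List Bool := runFold appF (pclipF 1 resBitF) id (eL ∘ fstF)

/-- Value of `resF`. [cite: Hirahara2018, Def. 4.5] -/
theorem resF_apply (f z : List Bool) (q ℓ m j : ℕ) :
    resF (boolPair (ectx f z q ℓ m) (ones j)) = NWStr.resBits q (LineDesign.lineWord q ℓ j) z := by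
  have hℓ : ((eL ∘ fstF) (boolPair (ectx f z q ℓ m) (ones j))).length = ℓ := by
    simp only [Function.comp_apply, fstF_boolPair, eL_ectx, ones, List.length_replicate]
  have hlen : ((eL ∘ fstF) (boolPair (ectx f z q ℓ m) (ones j))).length ≤ (id (boolPair (ectx f z q ℓ m) (ones j))).length := by
    rw [hℓ, id, length_boolPair]
    have := le_length_ectx f z q ℓ m
    omega
  rw [resF, runFold_apply _ _ _ _ hlen, hℓ, id,
    foldAcc_pclipF (fun t _ _ => by rw [resBitF_apply, length_boolPair]; simp), foldAcc_appF, List.nil_append]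
  rw [show (fun t => resBitF (boolPair (boolPair (ectx f z q ℓ m) (ones j)) (ones (0 + t)))) =
      fun t => [z.getD (t * q + LineDesign.lineVal q j t) false] from funext fun t => by rw [Nat.zero_add, resBitF_apply],
    ccat_singleton]
  apply List.ext_getElem
  · simp
  · intro t h1 h2
    rw [NWStr.getElem_resBits]
    simp

/-- `resF ∈ FP`. [folklore] -/
theorem resF_mem_FP : resF ∈ FP :=
  runFold_mem_FP appF_mem_FP (X + 0) (fun w => by simpa using length_appF_le w) (pclipF_mem_FP 1 resBitF_mem_FP) 1
    (length_pclipF_le 1 resBitF) (PolyTimeComputable.id _) (comp_mem_FP eL_mem_FP fstF_mem_FP)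

/-! ### Reading the truth table -/

/-- `⟨y, f⟩ ↦ [f(y)]` (`NWStr.fAt`: the bit of `f` at the little-endian value of `y`, `0` past the end;
the value is expanded to unary against the ruler `f` itself). [cite: Hirahara2018, Def. 4.5] -/
def fAtF : List Bool → List Bool := headBitFn ∘ dropFn ∘ fanoutFn (binToUnaryFn ∘ fanoutFn sndF fstF) sndF

/-- Value of `fAtF`. [folklore] -/
theorem fAtF_apply (y f : List Bool) : fAtF (boolPair y f) = [NWStr.fAt f y] := by
  simp only [fAtF, Function.comp_apply, fanoutFn_apply, fstF_boolPair, sndF_boolPair, binToUnaryFn_boolPair, dropFn_boolPair, headBitFn_apply,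
    NWStr.fAt, ones, List.length_replicate]
  rw [List.getD_eq_getElem?_getD, List.headD_eq_head?_getD, List.head?_drop]
  by_cases h : bitsToNat y < f.length
  · rw [min_eq_left h.le]
  · rw [min_eq_right (not_lt.1 h), List.getElem?_eq_none le_rfl, List.getElem?_eq_none (not_lt.1 h)]

/-- `fAtF ∈ FP`. [folklore] -/
theorem fAtF_mem_FP : fAtF ∈ FP :=
  comp_mem_FP headBitFn_mem_FP (comp_mem_FP dropFn_mem_FP (fanoutFn_mem_FP (comp_mem_FP binToUnaryFn_mem_FP (fanoutFn_mem_FP sndF_mem_FP fstF_mem_FP)) sndF_mem_FP))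

/-- **One output bit** `[f(z|_{S_j})]` on `⟨ctx, 1ʲ⟩`. [cite: Hirahara2018, Def. 4.5] -/
def yBitF : List Bool → List Bool := fAtF ∘ fanoutFn resF (eF ∘ fstF)

/-- Value of `yBitF`. [folklore] -/
theorem yBitF_apply (f z : List Bool) (q ℓ m j : ℕ) :
    yBitF (boolPair (ectx f z q ℓ m) (ones j)) = [NWStr.fAt f (NWStr.resBits q (LineDesign.lineWord q ℓ j) z)] := by
  simp only [yBitF, Function.comp_apply, fanoutFn_apply, resF_apply, fstF_boolPair, eF_ectx, fAtF_apply]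

/-- `yBitF ∈ FP`. [folklore] -/
theorem yBitF_mem_FP : yBitF ∈ FP := comp_mem_FP fAtF_mem_FP (fanoutFn_mem_FP resF_mem_FP (comp_mem_FP eF_mem_FP fstF_mem_FP))

/-! ### The generator -/

/-- **The NW generator on the design of lines**: `⟨⟨f, z⟩, ⟨1^q, ⟨1^ℓ, 1^m⟩⟩⟩ ↦ NW^f(z)`, the
concatenation fold of the `m` output bits. [cite: Hirahara2018, Def. 4.5] [cite: NisanWigderson1994, §2] -/
def nwEvalF : List Bool → List Bool := runFold appF (pclipF 1 yBitF) id eM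

/-- **Value of the generator**: `NWStr.nwOut q f (lineDesign q ℓ m) z`. [cite: Hirahara2018, Def. 4.5] -/
theorem nwEvalF_apply (f z : List Bool) (q ℓ m : ℕ) :
    nwEvalF (ectx f z q ℓ m) = NWStr.nwOut q f (LineDesign.lineDesign q ℓ m) z := by
  have hm : (eM (ectx f z q ℓ m)).length = m := by simp only [eM_ectx, ones, List.length_replicate]
  have hlen : (eM (ectx f z q ℓ m)).length ≤ (id (ectx f z q ℓ m)).length := by
    rw [hm, id]
    have := le_length_ectx f z q ℓ m
    omega
  rw [nwEvalF, runFold_apply _ _ _ _ hlen, hm, id,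
    foldAcc_pclipF (fun j _ _ => by rw [yBitF_apply]; simp), foldAcc_appF, List.nil_append]
  rw [show (fun j => yBitF (boolPair (ectx f z q ℓ m) (ones (0 + j)))) =
      fun j => [NWStr.fAt f (NWStr.resBits q (LineDesign.lineWord q ℓ j) z)] from funext fun j => by rw [Nat.zero_add, yBitF_apply],
    ccat_singleton]
  simp [NWStr.nwOut, LineDesign.lineDesign]

/-- **`nwEvalF ∈ FP`.** [cite: Hirahara2018, Lemma 4.10 (proof: "the running time … is at most `t + poly`")] -/
theorem nwEvalF_mem_FP : nwEvalF ∈ FP :=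
  runFold_mem_FP appF_mem_FP (X + 0) (fun w => by simpa using length_appF_le w) (pclipF_mem_FP 1 yBitF_mem_FP) 1
    (length_pclipF_le 1 yBitF) (PolyTimeComputable.id _) eM_mem_FP

/-- Length of the output: `m`. [folklore] -/
theorem length_nwEvalF (f z : List Bool) (q ℓ m : ℕ) : (nwEvalF (ectx f z q ℓ m)).length = m := by
  rw [nwEvalF_apply, NWStr.length_nwOut, LineDesign.length_lineDesign]

end NWLine

end Literature.Computability.MetaComplexity

end
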